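import Summits.ValiantsHypothesis.ValiantsHypothesis.Theorems.LacunarySymmetroidMatrixDescartesPivotArrowEightKit
import Summits.ValiantsHypothesis.ValiantsHypothesis.Theorems.LacunarySymmetroidMatrixDescartesPivotArrowTwo
import Summits.ValiantsHypothesis.ValiantsHypothesis.Theorems.LacunarySymmetroidMatrixDescartesPivotArrowFiveLetters

/-!
# `MatrixDescartes` (stmt-ValiantsHypothesis-18050) — THE `K = 5` PIVOT COLUMN AT ALL SIZES:
# `¬ PivotRootLawAt m 5 1 (8m − 7)` for EVERY `m`; the bilinear rank-one pivot law is SHARP along `K = 5` if true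

HONEST FRAMING.  Cell `pub-symmetroid`, seat `val-sym-mdr-p2` (gen 9); helper file `--supports` the crux
`Theses.LacunarySymmetroid.MatrixDescartes` (OPEN), NO closure claim.  A LOWER-bound / sharpness row for conjb-1's typed
pivot currency (`…CensusPivotDefs`: `Pivot.PivotRootLawAt m K q B`).  Desk successor item R2061 (B)(i) («K = 5 at all m via
the eight-point clone»).  Nothing here bears on `MatrixDescartes` in its window, on `stub_twoSided`, `DoorA26` / `DoorA34`,
the census registers, or `VP ≠ VNP`.

RESULT.  **`not_pivotRootLawAt_five_one : 1 ≤ m → ¬ PivotRootLawAt m 5 1 (8m − 7)`** — at format `(m, K) = (m, 5)` and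
pivot index ONE, `Z₊ ≥ 8m − 6` for every `m` (the tree had `10` at `m = 2`, `…PivotTwoFiveTen`, and `15` at `m = 4` with a
time-multiplexed staircase, `…CensusPivotMultiplexK5`).  `8m − 6 = 2(m−1)(K−1) + 2` is EXACTLY the budget of the typed
bilinear guess `Pivot.RankOnePivotLawBilinear` (conjb-1 g2, NOT asserted) at `K = 5`: **if the guess holds it is sharp along
the whole `K = 5` column** (`pivotRootLawAt_five_one_iff_of_bilinear`), as along `K = 2` (unconditionally exact,
`…PivotColumnTwo`), `K = 3` (`…WLawArrowPivot`) and `K = 4` (`…PivotArrowFour`).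

CONSTRUCTION (`exists_pivotConfig_indexOne`): the BALANCED arrowhead letters of `…PivotArrowFiveBlock` /
`…PivotArrowFiveLetters` (support `(3; 0, 2; 5, 19, 291)`, data of the `(2, 5)` TEN certificate) at separated scales
`Ξ₁ ≪ Ξ₂ ≪ ⋯`; by `det_pencil_eval` the determinant at `x > 0` is a positive multiple of
`x⁻³ − 1 + ∑ᵢ Uᵢ φ₅(x/Ξᵢ) + s x²⁸⁸`, and the reference shape `φ₅` (`→ 0` at both ends) crosses the level `953/100` EIGHT
times (`phi_p1` … `phi_p8`: `< 953/100` at `7/5, 253/200, 51/50, 3/20`, `> 953/100` at `161/125, 1169/1000, 23/50, 1/20`; a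
two-step in-block exponent staircase, margins ≥ 0.86 %); the generic soft induction `PivotArrowEight.model_alternates`
gives `8k + 2` alternations with `k` blocks, the slack `s x²⁸⁸` one more on the far right (`end_step`), the intermediate
value theorem (`WLawArrow.le_card_posRoots_of_alternating_anti`) `8k + 2 = 8(k+1) − 6` distinct positive roots in size
`k + 1`: per unit of size a balanced `K = 5` block contributes `8 = 2(K−1)` roots.

[folklore] Elementary; tree inputs `…PivotArrowEightKit`, `…PivotArrowFiveLetters`, `WLawArrow.prod_neg_of_alt`,
`WLawArrow.le_card_posRoots_of_alternating_anti`, `…CensusPivotDefs`.  Axioms `propext`, `Classical.choice`, `Quot.sound`.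
-/

set_option linter.dupNamespace false

namespace Summit.ValiantsHypothesis.ValiantsHypothesis.Theorems.LacunarySymmetroidMatrixDescartes

open scoped BigOperators Topology Matrix
open Filter Matrix Polynomial

namespace PivotArrowFive

/-- The reference block shape `φ₅` (local notation, no definition). -/
local notation3 (prettyPrint := false) "φ₅[" y "]" =>
  ((y : ℝ) ^ 2 * (4 * (8 / 125 + 307 / 100 * (y : ℝ) ^ 2) * (9385 + 1591 * (y : ℝ) ^ 14 + 15411 / 10 ^ 30 * (y : ℝ) ^ 286)
      - 321233929 / 10000 * (y : ℝ))
    / (8 / 125 + 307 / 100 * (y : ℝ) ^ 2 + 17923 / 100 * (y : ℝ) ^ 3 + 9385 * (y : ℝ) ^ 5 + 1591 * (y : ℝ) ^ 19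
      + 15411 / 10 ^ 30 * (y : ℝ) ^ 291))

/-- The scalar model `M₅(x) = x⁻³ − 1 + ∑ᵢ Uᵢ φ₅(x / Ξᵢ)` (local notation, no definition). -/
local notation3 (prettyPrint := false) "M₅[" Ξ ", " U "](" x ")" =>
  ((x : ℝ)⁻¹ ^ 3 - 1 + ∑ i, (U : Fin _ → ℝ) i * φ₅[(x : ℝ) / (Ξ : Fin _ → ℝ) i])

/-- Letter `P_a` (exponent `0`; local notation, no definition). -/
local notation3 (prettyPrint := false) "Pa5[" Ξ ", " U "]" =>
  Matrix.fromBlocks (diagonal fun i => 8 / 125 * (Ξ : Fin _ → ℝ) i ^ 579 / (U : Fin _ → ℝ) i)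
    (Matrix.of fun (i : Fin _) (_ : Fin 1) => 8 / 125 * (Ξ : Fin _ → ℝ) i ^ 291)
    (Matrix.of fun (_ : Fin 1) (i : Fin _) => 8 / 125 * (Ξ : Fin _ → ℝ) i ^ 291)
    (Matrix.of fun (_ _ : Fin 1) => (∑ i, 8 / 125 * (U : Fin _ → ℝ) i * (Ξ : Fin _ → ℝ) i ^ 3) + 1)

/-- Letter `P_b` (exponent `2`; local notation, no definition). -/
local notation3 (prettyPrint := false) "Pb5[" Ξ ", " U "]" =>
  Matrix.fromBlocks (diagonal fun i => 307 / 100 * (Ξ : Fin _ → ℝ) i ^ 577 / (U : Fin _ → ℝ) i)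
    (Matrix.of fun (i : Fin _) (_ : Fin 1) => 307 / 100 * (Ξ : Fin _ → ℝ) i ^ 289)
    (Matrix.of fun (_ : Fin 1) (i : Fin _) => 307 / 100 * (Ξ : Fin _ → ℝ) i ^ 289)
    (Matrix.of fun (_ _ : Fin 1) => ∑ i, 307 / 100 * (U : Fin _ → ℝ) i * (Ξ : Fin _ → ℝ) i)

/-- The pivot letter `J` (exponent `3`; diagonal; local notation, no definition). -/
local notation3 (prettyPrint := false) "J5[" Ξ ", " U "]" =>
  Matrix.fromBlocks (diagonal fun i => 17923 / 100 * (Ξ : Fin _ → ℝ) i ^ 576 / (U : Fin _ → ℝ) i) 0 0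
    (Matrix.of fun (_ _ : Fin 1) => -1 - 17923 / 100 * ∑ i, (U : Fin _ → ℝ) i)

/-- Letter `Q_c` (exponent `5`; local notation, no definition). -/
local notation3 (prettyPrint := false) "Qc5[" Ξ ", " U "]" =>
  Matrix.fromBlocks (diagonal fun i => 9385 * (Ξ : Fin _ → ℝ) i ^ 574 / (U : Fin _ → ℝ) i)
    (Matrix.of fun (i : Fin _) (_ : Fin 1) => -(9385 * (Ξ : Fin _ → ℝ) i ^ 286))
    (Matrix.of fun (_ : Fin 1) (i : Fin _) => -(9385 * (Ξ : Fin _ → ℝ) i ^ 286))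
    (Matrix.of fun (_ _ : Fin 1) => ∑ i, 9385 * (U : Fin _ → ℝ) i / (Ξ : Fin _ → ℝ) i ^ 2)

/-- Letter `Q_d` (exponent `19`; local notation, no definition). -/
local notation3 (prettyPrint := false) "Qd5[" Ξ ", " U "]" =>
  Matrix.fromBlocks (diagonal fun i => 1591 * (Ξ : Fin _ → ℝ) i ^ 560 / (U : Fin _ → ℝ) i)
    (Matrix.of fun (i : Fin _) (_ : Fin 1) => -(1591 * (Ξ : Fin _ → ℝ) i ^ 272))
    (Matrix.of fun (_ : Fin 1) (i : Fin _) => -(1591 * (Ξ : Fin _ → ℝ) i ^ 272))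
    (Matrix.of fun (_ _ : Fin 1) => ∑ i, 1591 * (U : Fin _ → ℝ) i / (Ξ : Fin _ → ℝ) i ^ 16)

/-- Letter `Q_e` (exponent `291`; carries the slack `s`; local notation, no definition). -/
local notation3 (prettyPrint := false) "Qe5[" Ξ ", " U ", " s "]" =>
  Matrix.fromBlocks (diagonal fun i => 15411 / 10 ^ 30 * (Ξ : Fin _ → ℝ) i ^ 288 / (U : Fin _ → ℝ) i)
    (Matrix.of fun (_ : Fin _) (_ : Fin 1) => -(15411 / 10 ^ 30 : ℝ))
    (Matrix.of fun (_ : Fin 1) (_ : Fin _) => -(15411 / 10 ^ 30 : ℝ))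
    (Matrix.of fun (_ _ : Fin 1) => (∑ i, 15411 / 10 ^ 30 * (U : Fin _ → ℝ) i / (Ξ : Fin _ → ℝ) i ^ 288) + (s : ℝ))

/-- Reindexing `Fin k ⊕ Fin 1 ≃ Fin (k + 1)` (local notation). -/
local notation3 (prettyPrint := false) "rx[" A "]" => Matrix.reindex finSumFinEquiv finSumFinEquiv A

/-- The five PSD letters as a `Fin 5`-family (local notation). -/
local notation3 (prettyPrint := false) "P5[" Ξ ", " U ", " s "]" =>
  (![rx[Pa5[Ξ, U]], rx[Pb5[Ξ, U]], rx[Qc5[Ξ, U]], rx[Qd5[Ξ, U]], rx[Qe5[Ξ, U, s]]] :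
    Fin 5 → Matrix (Fin (_ + 1)) (Fin (_ + 1)) ℝ)

/-! ## The reference block shape -/

/-- The denominator of `φ₅` is positive on `[0, ∞)`. [folklore] -/
theorem den_pos {y : ℝ} (hy : 0 ≤ y) :
    0 < 8 / 125 + 307 / 100 * y ^ 2 + 17923 / 100 * y ^ 3 + 9385 * y ^ 5 + 1591 * y ^ 19
      + 15411 / 10 ^ 30 * y ^ 291 := by positivity

set_option exponentiation.threshold 4096 in
/-- `φ₅(7/5) < 953/100` (the tail side of the block). [folklore] -/
theorem phi_p1 : φ₅[(7 / 5 : ℝ)] < 953 / 100 := by norm_num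

set_option exponentiation.threshold 4096 in
/-- `φ₅(161/125) > 953/100` (fourth excursion). [folklore] -/
theorem phi_p2 : (953 / 100 : ℝ) < φ₅[(161 / 125 : ℝ)] := by norm_num

set_option exponentiation.threshold 4096 in
/-- `φ₅(253/200) < 953/100` (third dip). [folklore] -/
theorem phi_p3 : φ₅[(253 / 200 : ℝ)] < 953 / 100 := by norm_num

set_option exponentiation.threshold 4096 in
/-- `φ₅(1169/1000) > 953/100` (third excursion). [folklore] -/
theorem phi_p4 : (953 / 100 : ℝ) < φ₅[(1169 / 1000 : ℝ)] := by norm_num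

set_option exponentiation.threshold 4096 in
/-- `φ₅(51/50) < 953/100` (second dip). [folklore] -/
theorem phi_p5 : φ₅[(51 / 50 : ℝ)] < 953 / 100 := by norm_num

set_option exponentiation.threshold 4096 in
/-- `φ₅(23/50) > 953/100` (second excursion). [folklore] -/
theorem phi_p6 : (953 / 100 : ℝ) < φ₅[(23 / 50 : ℝ)] := by norm_num

set_option exponentiation.threshold 4096 in
/-- `φ₅(3/20) < 953/100` (first dip). [folklore] -/
theorem phi_p7 : φ₅[(3 / 20 : ℝ)] < 953 / 100 := by norm_num

set_option exponentiation.threshold 4096 in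
/-- `φ₅(1/20) > 953/100` (first excursion). [folklore] -/
theorem phi_p8 : (953 / 100 : ℝ) < φ₅[(1 / 20 : ℝ)] := by norm_num

set_option exponentiation.threshold 4096 in
/-- `φ₅(y) → 0` as `y → 0`. [folklore] -/
theorem tendsto_phi_zero : Tendsto (fun y : ℝ => φ₅[y]) (𝓝 0) (𝓝 0) := by
  have h : ContinuousAt (fun y : ℝ => φ₅[y]) 0 := by
    refine ContinuousAt.div ?_ ?_ ?_
    · fun_prop
    · fun_prop
    · norm_num
  simpa using h.tendsto

set_option exponentiation.threshold 4096 in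
/-- `φ₅(y) → 0` as `y → ∞` (numerator degree `290`, denominator degree `291`). [folklore] -/
theorem tendsto_phi_atTop : Tendsto (fun y : ℝ => φ₅[y]) atTop (𝓝 0) := by
  have hg : Tendsto (fun u : ℝ => (4 * u * (8 / 125 * u ^ 2 + 307 / 100)
      * (9385 * u ^ 286 + 1591 * u ^ 272 + 15411 / 10 ^ 30) - 321233929 / 10000 * u ^ 288)
      / (8 / 125 * u ^ 291 + 307 / 100 * u ^ 289 + 17923 / 100 * u ^ 288 + 9385 * u ^ 286 + 1591 * u ^ 272
        + 15411 / 10 ^ 30)) (𝓝 0) (𝓝 0) := by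
    have hc : ContinuousAt (fun u : ℝ => (4 * u * (8 / 125 * u ^ 2 + 307 / 100)
        * (9385 * u ^ 286 + 1591 * u ^ 272 + 15411 / 10 ^ 30) - 321233929 / 10000 * u ^ 288)
        / (8 / 125 * u ^ 291 + 307 / 100 * u ^ 289 + 17923 / 100 * u ^ 288 + 9385 * u ^ 286 + 1591 * u ^ 272
          + 15411 / 10 ^ 30)) 0 := by
      refine ContinuousAt.div ?_ ?_ ?_
      · fun_prop
      · fun_prop
      · norm_num
    simpa using hc.tendsto
  refine (hg.comp tendsto_inv_atTop_zero).congr' ?_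
  filter_upwards [eventually_gt_atTop (0 : ℝ)] with y hy
  have hy' : y ≠ 0 := hy.ne'
  have hd : (8 / 125 + 307 / 100 * y ^ 2 + 17923 / 100 * y ^ 3 + 9385 * y ^ 5 + 1591 * y ^ 19
      + 15411 / 10 ^ 30 * y ^ 291) ≠ 0 := (den_pos hy.le).ne'
  simp only [Function.comp_apply]
  rw [div_eq_div_iff ?_ hd]
  · field_simp
  · have : 0 < 8 / 125 * y⁻¹ ^ 291 + 307 / 100 * y⁻¹ ^ 289 + 17923 / 100 * y⁻¹ ^ 288 + 9385 * y⁻¹ ^ 286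
        + 1591 * y⁻¹ ^ 272 + 15411 / 10 ^ 30 := by
      positivity
    exact this.ne'

/-! ## The end step: a small slack adds one sign change on the far right -/

/-- **The slack.**  Given the alternating data of the scalar model, some `s > 0` keeps all the signs of `M₅ + s x²⁸⁸` at
the listed points and some point `X` beyond the list has `M₅(X) + s X²⁸⁸ > 0`. [folklore] -/
theorem end_step {k m : ℕ} (Ξ U : Fin k → ℝ) (hΞ : ∀ i, 0 < Ξ i)
    (σ : Fin (m + 1) → ℝ) (hsign : ∀ j : Fin (m + 1), 0 < (-1 : ℝ) ^ ((j : ℕ) + 1) * M₅[Ξ, U](σ j)) :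
    ∃ s X : ℝ, 0 < s ∧ σ 0 < X ∧ 0 < M₅[Ξ, U](X) + s * X ^ 288 ∧
      ∀ j : Fin (m + 1), 0 < (-1 : ℝ) ^ ((j : ℕ) + 1) * (M₅[Ξ, U](σ j) + s * σ j ^ 288) := by
  have E : ∀ j : Fin (m + 1), ∀ᶠ s : ℝ in 𝓝[>] 0,
      0 < (-1 : ℝ) ^ ((j : ℕ) + 1) * (M₅[Ξ, U](σ j) + s * σ j ^ 288) := by
    intro j
    have ht : Tendsto (fun s : ℝ => (-1 : ℝ) ^ ((j : ℕ) + 1) * (M₅[Ξ, U](σ j) + s * σ j ^ 288)) (𝓝[>] 0)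
        (𝓝 ((-1 : ℝ) ^ ((j : ℕ) + 1) * (M₅[Ξ, U](σ j) + 0 * σ j ^ 288))) :=
      tendsto_nhdsWithin_of_tendsto_nhds (((tendsto_id.mul_const _).const_add _).const_mul _)
    rw [zero_mul, add_zero] at ht
    exact ht.eventually_const_lt (hsign j)
  obtain ⟨s, hs, hsigns⟩ :=
    ((eventually_mem_nhdsWithin (a := (0 : ℝ)) (s := Set.Ioi 0)).and (eventually_all.2 E)).exists
  rw [Set.mem_Ioi] at hs
  have hM : Tendsto (fun x : ℝ => M₅[Ξ, U](x)) atTop (𝓝 (-1)) := by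
    simpa only using PivotArrowSix.model_tendsto_atTop (fun y => φ₅[y]) tendsto_phi_atTop Ξ U hΞ
  have hT : Tendsto (fun x : ℝ => M₅[Ξ, U](x) + s * x ^ 288) atTop atTop :=
    hM.add_atTop ((tendsto_pow_atTop (by norm_num : (288 : ℕ) ≠ 0)).const_mul_atTop hs)
  obtain ⟨X, hX1, hX2⟩ := ((hT.eventually_gt_atTop 0).and (eventually_gt_atTop (σ 0))).exists
  exact ⟨s, X, hs, hX2, hX1, hsigns⟩

/-! ## The theorems -/

/-- **BALANCED ARROWHEAD PIVOT PENCILS WITH `8k + 2` POSITIVE ROOTS IN EVERY SIZE `k + 1`, INDEX ONE.**  For every `k`: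
an explicit `(k+1) × (k+1)` pivot pencil with five PSD letters on the exponents `(0, 2, 5, 19, 291)`, pivot exponent `3`,
`J` symmetric with `J + W Wᵀ ⪰ 0` for ONE column `W`, and at least `8k + 2` distinct positive determinant roots.
[folklore] -/
theorem exists_pivotConfig_indexOne (k : ℕ) :
    ∃ (J : Matrix (Fin (k + 1)) (Fin (k + 1)) ℝ) (P : Fin 5 → Matrix (Fin (k + 1)) (Fin (k + 1)) ℝ)
      (W : Matrix (Fin (k + 1)) (Fin 1) ℝ),
      J.IsSymm ∧ (∀ l, (P l).PosSemidef) ∧ (J + W * Wᵀ).PosSemidef ∧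
      8 * k + 2 ≤ Pivot.pivotPosRoots 3 (![0, 2, 5, 19, 291] : Fin 5 → ℕ) J P := by
  obtain ⟨Ξ, U, σ, hΞ, hU, hanti, hpos, hsign⟩ :=
    PivotArrowEight.model_alternates (fun y => φ₅[y]) tendsto_phi_zero tendsto_phi_atTop
      (θ := 953 / 100) (p₁ := 7 / 5) (p₂ := 161 / 125) (p₃ := 253 / 200) (p₄ := 1169 / 1000) (p₅ := 51 / 50)
      (p₆ := 23 / 50) (p₇ := 3 / 20) (p₈ := 1 / 20)
      (by norm_num) (by norm_num) (by norm_num) (by norm_num) (by norm_num) (by norm_num) (by norm_num)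
      (by norm_num) (by norm_num)
      phi_p1 phi_p2 phi_p3 phi_p4 phi_p5 phi_p6 phi_p7 phi_p8 k
  have hsign' : ∀ j : Fin (8 * k + 1 + 1), 0 < (-1 : ℝ) ^ ((j : ℕ) + 1) * M₅[Ξ, U](σ j) := fun j => by
    simpa only using hsign j
  obtain ⟨s, Xr, hs, hX, hXval, hsigns⟩ := end_step Ξ U hΞ σ hsign'
  obtain ⟨W, hW⟩ := indexOne_J Ξ U hU
  refine ⟨rx[J5[Ξ, U]], P5[Ξ, U, s], W, isSymm_J Ξ U, posSemidef_letters Ξ U hΞ hU hs.le, hW, ?_⟩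
  have hρpos : ∀ j, 0 < (vecCons Xr σ) j := by
    intro j
    refine Fin.cases ?_ (fun i => ?_) j
    · simpa using (hpos 0).trans hX
    · simpa using hpos i
  unfold Pivot.pivotPosRoots
  refine WLawArrow.le_card_posRoots_of_alternating_anti _ (8 * k + 1 + 1) (vecCons Xr σ) (hanti.vecCons hX) hρpos
    fun j => ?_
  refine Fin.cases ?_ (fun i => ?_) j
  · have h0 := hsigns 0
    simp only [Fin.val_zero, zero_add, pow_one] at h0
    rw [Fin.castSucc_zero, Matrix.cons_val_zero, Fin.succ_zero_eq_one, Matrix.cons_val_one]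
    exact eval_mul_eval_neg Ξ U hΞ hU s ((hpos 0).trans hX) (hpos 0) (mul_neg_of_pos_of_neg hXval (by linarith))
  · rw [← Fin.succ_castSucc, Matrix.cons_val_succ, Matrix.cons_val_succ]
    exact eval_mul_eval_neg Ξ U hΞ hU s (hpos _) (hpos _)
      (WLawArrow.prod_neg_of_alt (fun x => M₅[Ξ, U](x) + s * x ^ 288) σ hsigns i)

end PivotArrowFive

/-- **`Z₊ ≥ 8m − 6` AT `(m, K) = (m, 5)`, INDEX ONE, EVERY `m`**: `¬ PivotRootLawAt m 5 1 (8m − 7)` for all `m ≥ 1`.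
[folklore] -/
theorem not_pivotRootLawAt_five_one {m : ℕ} (hm : 1 ≤ m) : ¬ Pivot.PivotRootLawAt m 5 1 (8 * m - 7) := by
  obtain ⟨k, rfl⟩ : ∃ k, m = k + 1 := ⟨m - 1, by omega⟩
  intro h
  obtain ⟨J, P, W, hJ, hP, hW, hA⟩ := PivotArrowFive.exists_pivotConfig_indexOne k
  have h5 := h 3 ![0, 2, 5, 19, 291] J P hJ hP ⟨W, hW⟩
  omega

/-- In law form: `PivotRootLawAt m 5 1 B → 8m − 6 ≤ B` (`m ≥ 1`). [bookkeeping] -/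
theorem le_of_pivotRootLawAt_five_one {m B : ℕ} (hm : 1 ≤ m) (h : Pivot.PivotRootLawAt m 5 1 B) :
    8 * m - 6 ≤ B := by
  by_contra hB
  exact not_pivotRootLawAt_five_one hm (Pivot.pivotRootLawAt_mono h (by omega))

/-- **The bilinear rank-one pivot law is SHARP along `K = 5` if it holds**: under `RankOnePivotLawBilinear` (typed, NOT
asserted), `PivotRootLawAt m 5 1 B ↔ 8m − 6 ≤ B` for every `m ≥ 1`. [bookkeeping] -/
theorem pivotRootLawAt_five_one_iff_of_bilinear (hbil : Pivot.RankOnePivotLawBilinear) {m B : ℕ} (hm : 1 ≤ m) :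
    Pivot.PivotRootLawAt m 5 1 B ↔ 8 * m - 6 ≤ B := by
  refine ⟨le_of_pivotRootLawAt_five_one hm, fun hB => ?_⟩
  have h := hbil m 5
  refine Pivot.pivotRootLawAt_mono h ?_
  omega

/-- **Summary — the index-one pivot columns `K = 2, 3, 4, 5` at every size**: unconditionally `Z₊` reaches `2m`, `4m − 2`,
`6m − 4`, `8m − 6` (`= 2(m−1)(K−1) + 2`); under the typed bilinear guess these are the exact rows (the `K = 2` column is
exact unconditionally, `…PivotColumnTwo`). [bookkeeping] -/
theorem indexOne_columns_sharp_of_bilinear₅ (hbil : Pivot.RankOnePivotLawBilinear) {m : ℕ} (hm : 1 ≤ m) :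
    (∀ B, Pivot.PivotRootLawAt m 2 1 B ↔ 2 * m ≤ B) ∧ (∀ B, Pivot.PivotRootLawAt m 3 1 B ↔ 4 * m - 2 ≤ B) ∧
      (∀ B, Pivot.PivotRootLawAt m 4 1 B ↔ 6 * m - 4 ≤ B) ∧ (∀ B, Pivot.PivotRootLawAt m 5 1 B ↔ 8 * m - 6 ≤ B) :=
  ⟨fun _ => pivotRootLawAt_two_one_iff_of_bilinear hbil hm, fun _ => pivotRootLawAt_three_one_iff_of_bilinear hbil hm,
    fun _ => pivotRootLawAt_four_one_iff_of_bilinear hbil hm, fun _ => pivotRootLawAt_five_one_iff_of_bilinear hbil hm⟩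

end Summit.ValiantsHypothesis.ValiantsHypothesis.Theorems.LacunarySymmetroidMatrixDescartes
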